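import Mathlib
import Summits.Ventures.HSemireg.LineLawPrincipalProper

/-!
# LINE LAW — the bookkeeping gcd hypotheses hold on every reached line (ENGINE-W code B, #B21)

The one-sided bookkeeping `𝔞_{n₁}(A)·𝔞_{n₂}(A) = 𝔞_{n₁n₂}(A)` (#B14 `LineLawIdealProduct`) carries the hypothesis `gcd(n₁, n₂, 2A) = 1`.
In THEOREM E «⇐» ∕ the «which T» corollary (#B20 `LineLawClassLawSufficiency.weightDatum_of_aligned` ∕ `firstWinding_relation`) it
appears as `gcd(L∕c, c, 2A) = 1` and `gcd(s, L∕c, 2A) = 1` resp. `gcd(s, L, 2A) = 1` for a weight `c` of a line at winding `T = s·L`.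
This file shows — from #B16's identity alone (`LineLawPrincipalProper.no_prime_dvd`: no prime divides `N z`, `N w` and `2A` on a datum
`z·w = A − √m`) — that these gcds hold AUTOMATICALLY on a reached line (LINE-LAW-THEOREMS-B.md, REMARK after §6⁗; complements REF-W
P-FT-2), for every integer `m`:
* `no_prime_coweight_weight` ∕ `gcd_coweight_weight` — a datum of the weight `c` with `N z = s·d` (`T = c·N z`, `T ∣ A² − m`): no prime
  divides `d`, `c` and `2A` (it would divide `N z` via `d` and `N w` via `c ∣ N w`);
* `no_prime_cofactor_weight` — a datum of a weight `c'` with `c' ∣ L`, `T = s·L`: no prime divides `s`, `c'` and `2A`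
  (`N z' = s·(L∕c')`, `c' ∣ N w'`);
* `gcd_cofactor_lcm` — hence on a finite family whose every prime of `L` divides some weight (e.g. `L = lcm`), `gcd(s, L, 2A) = 1`.
Honest framing: integer ∕ `ℤ√m` arithmetic only; THEOREM CF⁶ by value; Mukai vectors and lattices elsewhere, not objects; nothing here says
that HC, HC_CM or HC_AV holds.
-/

namespace Summit.Ventures.HSemireg.LineLawBookkeepingGcds

open Zsqrtd
open Summit.Ventures.HSemireg.LineLawPrincipalProper (no_prime_dvd weight_dvd_conorm)

/-- On a datum `z·w = A − √m` of the weight `c` (`T = c·N z ≠ 0`, `T ∣ A² − m`) with `N z = s·d`: no prime divides `d`, `c` and `2A`. -/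
theorem no_prime_coweight_weight {m A T c s d : ℤ} {z w : ℤ√m} (h : z * w = ⟨A, -1⟩) (hT : T = c * z.norm)
    (hsd : z.norm = s * d) (hdiv : T ∣ A * A - m) (hn : z.norm ≠ 0) {q : ℤ} (hq : Prime q)
    (h1 : q ∣ d) (h2 : q ∣ c) (h3 : q ∣ 2 * A) : False :=
  no_prime_dvd h hq (by rw [hsd]; exact dvd_mul_of_dvd_right h1 _) (dvd_trans h2 (weight_dvd_conorm h hT hdiv hn)) h3

/-- The same as the #B14 ∕ #B20 hypothesis `gcd(d, c, 2A) = 1` (`d = L∕c` when `N z = s·(L∕c)`). -/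
theorem gcd_coweight_weight {m A T c s d : ℤ} {z w : ℤ√m} (h : z * w = ⟨A, -1⟩) (hT : T = c * z.norm)
    (hsd : z.norm = s * d) (hdiv : T ∣ A * A - m) (hn : z.norm ≠ 0) : Int.gcd (Int.gcd d c : ℤ) (2 * A) = 1 := by
  by_contra hne
  obtain ⟨p, hp, hpg⟩ := Nat.exists_prime_and_dvd hne
  have hpZ : (p : ℤ) ∣ ((Int.gcd (Int.gcd d c : ℤ) (2 * A) : ℕ) : ℤ) := by exact_mod_cast hpg
  have hg1 : (((Int.gcd (Int.gcd d c : ℤ) (2 * A)) : ℕ) : ℤ) ∣ ((Int.gcd d c : ℕ) : ℤ) := Int.gcd_dvd_left _ _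
  exact no_prime_coweight_weight h hT hsd hdiv hn (Nat.prime_iff_prime_int.1 hp)
    (dvd_trans (dvd_trans hpZ hg1) (Int.gcd_dvd_left _ _)) (dvd_trans (dvd_trans hpZ hg1) (Int.gcd_dvd_right _ _))
    (dvd_trans hpZ (Int.gcd_dvd_right _ _))

/-- On a datum `z'·w' = A − √m` of a weight `c'` with `c' ∣ L` at winding `T = s·L` (`T ≠ 0`, `T ∣ A² − m`): no prime divides `s`,
`c'` and `2A` — it would divide `N z' = s·(L∕c')` and `N w'` (as `c' ∣ N w'`). -/
theorem no_prime_cofactor_weight {m A T c' s L : ℤ} {z' w' : ℤ√m} (h' : z' * w' = ⟨A, -1⟩) (hT' : T = c' * z'.norm)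
    (hsL : T = s * L) (hc'L : c' ∣ L) (hdiv : T ∣ A * A - m) (hT0 : T ≠ 0) {q : ℤ} (hq : Prime q)
    (h1 : q ∣ s) (h2 : q ∣ c') (h3 : q ∣ 2 * A) : False := by
  have hn' : z'.norm ≠ 0 := by intro h0; apply hT0; rw [hT', h0, mul_zero]
  have hc'0 : c' ≠ 0 := by intro h0; apply hT0; rw [hT', h0, zero_mul]
  obtain ⟨k, hk⟩ := hc'L
  -- `N z' = s k`
  have hz' : z'.norm = s * k := by
    apply mul_left_cancel₀ hc'0
    rw [← hT', hsL, hk]; ring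
  exact no_prime_dvd h' hq (by rw [hz']; exact dvd_mul_of_dvd_left h1 _)
    (dvd_trans h2 (weight_dvd_conorm h' hT' hdiv hn')) h3

/-- **`gcd(s, L, 2A) = 1` on a reached line.**  A finite family of weights `c i ∣ L` (`i ∈ S`) such that every prime factor of `L`
divides some weight (true for `L = lcm` of the weights), with data `z i · w i = A − √m`, `T = c i · N (z i)` at `T = s·L ≠ 0`,
`T ∣ A² − m`: then `gcd(s, L, 2A) = 1` — the hypothesis `hg` of #B20's `firstWinding_relation` and (with `gcd_coweight_weight`) `hg2` of
`weightDatum_of_aligned` at `r = s`. -/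
theorem gcd_cofactor_lcm {m A T s L : ℤ} {ι : Type*} (S : Finset ι) (c : ι → ℤ) (z w : ι → ℤ√m)
    (h : ∀ i ∈ S, z i * w i = ⟨A, -1⟩) (hT : ∀ i ∈ S, T = c i * (z i).norm) (hcL : ∀ i ∈ S, c i ∣ L)
    (hcover : ∀ q : ℤ, Prime q → q ∣ L → ∃ i ∈ S, q ∣ c i) (hsL : T = s * L) (hdiv : T ∣ A * A - m) (hT0 : T ≠ 0) :
    Int.gcd (Int.gcd s L : ℤ) (2 * A) = 1 := by
  by_contra hne
  obtain ⟨p, hp, hpg⟩ := Nat.exists_prime_and_dvd hne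
  have hpZ : (p : ℤ) ∣ ((Int.gcd (Int.gcd s L : ℤ) (2 * A) : ℕ) : ℤ) := by exact_mod_cast hpg
  have hg1 : (((Int.gcd (Int.gcd s L : ℤ) (2 * A)) : ℕ) : ℤ) ∣ ((Int.gcd s L : ℕ) : ℤ) := Int.gcd_dvd_left _ _
  have hps : (p : ℤ) ∣ s := dvd_trans (dvd_trans hpZ hg1) (Int.gcd_dvd_left _ _)
  have hpL : (p : ℤ) ∣ L := dvd_trans (dvd_trans hpZ hg1) (Int.gcd_dvd_right _ _)
  have hpA : (p : ℤ) ∣ 2 * A := dvd_trans hpZ (Int.gcd_dvd_right _ _)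
  have hq := Nat.prime_iff_prime_int.1 hp
  obtain ⟨i, hi, hpi⟩ := hcover (p : ℤ) hq hpL
  exact no_prime_cofactor_weight (h i hi) (hT i hi) hsL (hcL i hi) hdiv hT0 hq hps hpi hpA

end Summit.Ventures.HSemireg.LineLawBookkeepingGcds
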